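import Summits.RiemannHypothesis.RiemannHypothesis.Theorems.WeilFormatCCinfDoorPoly
import HarnessLib

/-!
# Format C, design C∞ (E3, analytic side): the far-coupling MAJORANT `Uq` of the front door as ONE quadratic form

Route context: Fourier–Galerkin / Schur-complement certificates of Weil positivity on a window ("format C", C∞ door;
cell memo `run/shared/lean/pub/rh-explicit/rh-explicit-weil-10/KERNEL-LEVER.md` §22; supporting stmt-RiemannHypothesis-0098;
seat rh-explicit-weil-10).  The hypothesis `hUqe'` (`hUqo'`) of `weilPositivityOn_of_cinf_poly` asks for a form `Uq`
dominating `Ufin(x,β) + ((1+θ)·Γ(u(x,β)) + (1+θ⁻¹)·W·(Σρ)·(Σ_i ρ_i x_i² + Σ_j ρ̃_j β_j²))/d₁`, where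
`u_f(x,β) = Σ_i A₁(f,i)x_i + Σ_j A₂(f,j)β_j` is the explicit linear map of the collected coefficients.  When the
exact middle range is a quadratic form `Ufin = zᵀU_f z` (`z = (x,β)` on `Fin (B+1) ⊕ Fin r`) and the family Gram
majorant has the box shape `Γ(u) = Σ_f Σ_{f'} u_f u_{f'} G(f,f') + Σ_f u_f² c_f` (`WeilFormatCFamilyGram`,
`WeilFormatCCinfGramData`, `WeilFormatCCinfGramHankel`), the whole majorant IS a quadratic form `zᵀQz` with the
explicit matrix
`Q = U_f + ((1+θ)·(AᵀGA + Σ_f c_f A_fᵀA_f) + (1+θ⁻¹)·W·(Σρ)·diag(ρ, ρ̃))/d₁`, so the rung may take `Uq := zᵀQz`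
with `hUq'` by `le_of_eq`, and the margin `hS` becomes ONE kernel PSD check of the boxed matrix
`S = (resolved entries) − Q − δ·1` (`WeilFormatCCinfMarginForm`).

* `majorant_eq_quadForm` — the algebra (generic);
* `cinf_hUq'_even` / `cinf_hUq'_odd` — LITERALLY the `hUqe'` / `hUqo'` hypotheses of `weilPositivityOn_of_cinf_poly`
  for `Ufin := zᵀU_f z`, `Γ := box shape`, `Uq := zᵀQz`.

Pure finite-dimensional algebra; standard axioms; no definitions; no RH claim.
-/

set_option autoImplicit false
-- `Summit.RiemannHypothesis.RiemannHypothesis.…` is the layout-mandated namespace (summit = problem name).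
set_option linter.dupNamespace false

noncomputable section

open Complex Filter Set MeasureTheory Finset
open scoped Real Topology ComplexConjugate

namespace Summit.RiemannHypothesis.RiemannHypothesis.Theorems.WeilFormatC

open Literature.NumberTheory.LFunctions Literature.NumberTheory.LFunctions.Yoshida1992

variable {a : ℝ}

/-! ## Generic algebra -/

/-- Commuting a quadruple sum (local copy of `sum4_comm`, `WeilFormatCCinfGramData`). -/
private theorem sum4_comm_loc {ι κ : Type*} [Fintype ι] [Fintype κ] (F : ι → ι → κ → κ → ℝ) :
    ∑ f, ∑ f', ∑ k, ∑ k', F f f' k k' = ∑ k, ∑ k', ∑ f, ∑ f', F f f' k k' := by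
  have h1 : ∀ f : ι, ∑ f', ∑ k, ∑ k', F f f' k k' = ∑ k, ∑ k', ∑ f', F f f' k k' := by
    intro f
    rw [Finset.sum_comm]
    exact Finset.sum_congr rfl fun k _ ↦ Finset.sum_comm
  simp_rw [h1]
  rw [Finset.sum_comm]
  exact Finset.sum_congr rfl fun k _ ↦ Finset.sum_comm

/-- `Γ(u(z))` as a quadratic form in `z` (local copy of `gramMajorant_comp_linear`, `WeilFormatCCinfGramData`). -/
private theorem gramMajorant_comp_linear_loc {ι κ : Type*} [Fintype ι] [Fintype κ] (G : ι → ι → ℝ) (c : ι → ℝ)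
    (A : ι → κ → ℝ) (z : κ → ℝ) :
    (∑ f, ∑ f', (∑ k, A f k * z k) * (∑ k, A f' k * z k) * G f f') + ∑ f, c f * (∑ k, A f k * z k) ^ 2
      = ∑ k, ∑ k', z k * z k' * ((∑ f, ∑ f', A f k * A f' k' * G f f') + ∑ f, c f * A f k * A f k') := by
  have h1 : ∀ f f', (∑ k, A f k * z k) * (∑ k, A f' k * z k) * G f f'
      = ∑ k, ∑ k', z k * z k' * (A f k * A f' k' * G f f') := by
    intro f f'
    rw [Finset.sum_mul_sum, Finset.sum_mul]
    refine Finset.sum_congr rfl fun k _ ↦ ?_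
    rw [Finset.sum_mul]
    exact Finset.sum_congr rfl fun k' _ ↦ by ring
  have h2 : ∀ f, c f * (∑ k, A f k * z k) ^ 2 = ∑ k, ∑ k', z k * z k' * (c f * A f k * A f k') := by
    intro f
    rw [sq, Finset.sum_mul_sum, Finset.mul_sum]
    refine Finset.sum_congr rfl fun k _ ↦ ?_
    rw [Finset.mul_sum]
    exact Finset.sum_congr rfl fun k' _ ↦ by ring
  simp_rw [h1, h2]
  rw [sum4_comm_loc (fun f f' k k' ↦ z k * z k' * (A f k * A f' k' * G f f'))]
  have h3 : ∑ f, ∑ k, ∑ k', z k * z k' * (c f * A f k * A f k') = ∑ k, ∑ k', ∑ f, z k * z k' * (c f * A f k * A f k') := by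
    rw [Finset.sum_comm]
    exact Finset.sum_congr rfl fun k _ ↦ Finset.sum_comm
  rw [h3, ← Finset.sum_add_distrib]
  refine Finset.sum_congr rfl fun k _ ↦ ?_
  rw [← Finset.sum_add_distrib]
  refine Finset.sum_congr rfl fun k' _ ↦ ?_
  rw [mul_add, Finset.mul_sum, Finset.mul_sum]
  congr 1
  exact Finset.sum_congr rfl fun f _ ↦ by rw [Finset.mul_sum]

/-- Two blocks as one vector (local copy of `linearForm_sum_elim`, `WeilFormatCCinfGramData`). -/
private theorem linearForm_sum_elim_loc {B r : ℕ} (P : Fin B → ℝ) (Q : Fin r → ℝ) (x : Fin B → ℝ) (β : Fin r → ℝ) :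
    ∑ k : Fin B ⊕ Fin r, Sum.elim P Q k * Sum.elim x β k = ∑ i, P i * x i + ∑ j, Q j * β j := by
  rw [Fintype.sum_sum_type]
  simp only [Sum.elim_inl, Sum.elim_inr]

/-- **The far-coupling majorant as ONE quadratic form.**  For `z = (x,β)` on `Fin B ⊕ Fin r`,
`u_f = Σ_i A₁(f,i)x_i + Σ_j A₂(f,j)β_j`:
`zᵀU_f z + ((1+θ)(Σ_fΣ_{f'} u_f u_{f'} G(f,f') + Σ_f u_f² c_f) + (1+θ⁻¹)·W·R·(Σ_i ρ₁(i)x_i² + Σ_j ρ₂(j)β_j²))/d = zᵀQz`,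
`Q(k,k') = U_f(k,k') + ((1+θ)(Σ_fΣ_{f'} A(f,k)A(f',k')G(f,f') + Σ_f c_f A(f,k)A(f,k')) + (1+θ⁻¹)·W·R·[k=k']ρ(k))/d`
with `A(f,·) = (A₁(f,·), A₂(f,·))`, `ρ = (ρ₁, ρ₂)`. -/
theorem majorant_eq_quadForm {ι : Type*} [Fintype ι] {B r : ℕ}
    (Uf : Fin B ⊕ Fin r → Fin B ⊕ Fin r → ℝ) (G : ι → ι → ℝ) (c : ι → ℝ)
    (A1 : ι → Fin B → ℝ) (A2 : ι → Fin r → ℝ) (ρ1 : Fin B → ℝ) (ρ2 : Fin r → ℝ) (θ W R d : ℝ)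
    (x : Fin B → ℝ) (β : Fin r → ℝ) :
    (∑ k, ∑ k', Sum.elim x β k * Sum.elim x β k' * Uf k k')
        + ((1 + θ) * ((∑ f, ∑ f', (∑ i, A1 f i * x i + ∑ j, A2 f j * β j) * (∑ i, A1 f' i * x i + ∑ j, A2 f' j * β j)
                          * G f f')
                      + ∑ f, (∑ i, A1 f i * x i + ∑ j, A2 f j * β j) ^ 2 * c f)
            + (1 + 1 / θ) * (W * (R * (∑ i, ρ1 i * x i ^ 2 + ∑ j, ρ2 j * β j ^ 2)))) / d
      = ∑ k, ∑ k', Sum.elim x β k * Sum.elim x β k' *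
          (Uf k k' + ((1 + θ) * ((∑ f, ∑ f', Sum.elim (A1 f) (A2 f) k * Sum.elim (A1 f') (A2 f') k' * G f f')
                                  + ∑ f, c f * Sum.elim (A1 f) (A2 f) k * Sum.elim (A1 f) (A2 f) k')
                      + (1 + 1 / θ) * (W * R) * (if k = k' then Sum.elim ρ1 ρ2 k else 0)) / d) := by
  classical
  -- the Gram part
  have hΓ : (∑ f, ∑ f', (∑ i, A1 f i * x i + ∑ j, A2 f j * β j) * (∑ i, A1 f' i * x i + ∑ j, A2 f' j * β j) * G f f')
        + ∑ f, (∑ i, A1 f i * x i + ∑ j, A2 f j * β j) ^ 2 * c f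
      = ∑ k, ∑ k', Sum.elim x β k * Sum.elim x β k' *
          ((∑ f, ∑ f', Sum.elim (A1 f) (A2 f) k * Sum.elim (A1 f') (A2 f') k' * G f f')
            + ∑ f, c f * Sum.elim (A1 f) (A2 f) k * Sum.elim (A1 f) (A2 f) k') := by
    simp_rw [← linearForm_sum_elim_loc]
    rw [← gramMajorant_comp_linear_loc G c (fun f k ↦ Sum.elim (A1 f) (A2 f) k) (Sum.elim x β)]
    congr 1
    exact Finset.sum_congr rfl fun f _ ↦ by ring
  -- the diagonal remainder part
  have hD : ∑ i, ρ1 i * x i ^ 2 + ∑ j, ρ2 j * β j ^ 2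
      = ∑ k : Fin B ⊕ Fin r, ∑ k', Sum.elim x β k * Sum.elim x β k' * (if k = k' then Sum.elim ρ1 ρ2 k else 0) := by
    have h1 : ∀ k : Fin B ⊕ Fin r, ∑ k', Sum.elim x β k * Sum.elim x β k' * (if k = k' then Sum.elim ρ1 ρ2 k else 0)
        = Sum.elim ρ1 ρ2 k * Sum.elim x β k ^ 2 := by
      intro k
      simp only [mul_ite, mul_zero, Finset.sum_ite_eq, Finset.mem_univ, if_true]
      ring
    simp_rw [h1]
    rw [Fintype.sum_sum_type]
    simp only [Sum.elim_inl, Sum.elim_inr]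
  rw [hΓ, hD]
  -- linearity in the matrix entries
  have hlin : ∀ k k' : Fin B ⊕ Fin r, Sum.elim x β k * Sum.elim x β k' *
      (Uf k k' + ((1 + θ) * ((∑ f, ∑ f', Sum.elim (A1 f) (A2 f) k * Sum.elim (A1 f') (A2 f') k' * G f f')
                                  + ∑ f, c f * Sum.elim (A1 f) (A2 f) k * Sum.elim (A1 f) (A2 f) k')
                      + (1 + 1 / θ) * (W * R) * (if k = k' then Sum.elim ρ1 ρ2 k else 0)) / d)
      = Sum.elim x β k * Sum.elim x β k' * Uf k k'
        + ((1 + θ) / d) * (Sum.elim x β k * Sum.elim x β k' *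
            ((∑ f, ∑ f', Sum.elim (A1 f) (A2 f) k * Sum.elim (A1 f') (A2 f') k' * G f f')
              + ∑ f, c f * Sum.elim (A1 f) (A2 f) k * Sum.elim (A1 f) (A2 f) k'))
        + ((1 + 1 / θ) * (W * R) / d) * (Sum.elim x β k * Sum.elim x β k' *
            (if k = k' then Sum.elim ρ1 ρ2 k else 0)) := fun k k' ↦ by ring
  simp only [hlin, Finset.sum_add_distrib, ← Finset.mul_sum]
  ring


/-! ## The `hUq'` hypotheses of the front door -/

/-- **`hUqe'` of `weilPositivityOn_of_cinf_poly` by `le_of_eq`**: with `Ufine := zᵀU_f z`,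
`Γe := fun u ↦ Σ_fΣ_{f'} u_f u_{f'} G(f,f') + Σ_f u_f² c_f` and `Uqe := zᵀQz` (`Q` explicit below: the even collected
coefficients `Prowe, Pimge, Rtabe`, the free maps `Λ1e, Λ2e`, the profiles `coefe`, the remainders `ρrowe, ρimge`, the
low profile tables, `We`, `θe`, `d₁e`), the far-coupling majorant IS `Uqe`. -/
theorem cinf_hUq'_even (a : ℝ) {Be re : ℕ} (se : Finset ℕ) (coefe : Fin re → ℕ → ℝ)
    (Λ1e : Fin re → Fin (Be + 1) → ℝ) (Λ2e : Fin re → Fin re → ℝ)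
    {ι : Type*} [Fintype ι] (Prowe : ℕ → ι → ℝ) (ρrowe : ℕ → ℝ) (Pimge : ℕ → ι → ℝ) (ρimge : ℕ → ℝ)
    (Rtabe : Fin re → ι → ℝ) (We θe d₁e : ℝ)
    (Uf : Fin (Be + 1) ⊕ Fin re → Fin (Be + 1) ⊕ Fin re → ℝ) (G : ι → ι → ℝ) (c : ι → ℝ)
    (x : Fin (Be + 1) → ℝ) (β : Fin re → ℝ) :
    (∑ k, ∑ k', Sum.elim x β k * Sum.elim x β k' * Uf k k')
        + ((1 + θe) * ((∑ f, ∑ f', (∑ i : Fin (Be + 1), (Prowe i f - ∑ j, Rtabe j f * Λ1e j i) * x i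
            + ∑ j', ((∑ q ∈ se, coefe j' q * Pimge q f
                      - ∑ n ∈ Finset.range (Be + 1), ((if n = 0 then 1 else 2) * (Yoshida1992.fourierCoeff a n ((Icc (-a) a).indicator fun x : ℝ ↦ ∑ q ∈ se, ((coefe j' q : ℝ) : ℂ) * ((x : ℂ)) ^ q)).re / Real.sqrt (2 * a)) * Prowe n f)
                    - ∑ j, Rtabe j f * Λ2e j j') * β j')
              * (∑ i : Fin (Be + 1), (Prowe i f' - ∑ j, Rtabe j f' * Λ1e j i) * x i
            + ∑ j', ((∑ q ∈ se, coefe j' q * Pimge q f'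
                      - ∑ n ∈ Finset.range (Be + 1), ((if n = 0 then 1 else 2) * (Yoshida1992.fourierCoeff a n ((Icc (-a) a).indicator fun x : ℝ ↦ ∑ q ∈ se, ((coefe j' q : ℝ) : ℂ) * ((x : ℂ)) ^ q)).re / Real.sqrt (2 * a)) * Prowe n f')
                    - ∑ j, Rtabe j f' * Λ2e j j') * β j') * G f f')
            + ∑ f, (∑ i : Fin (Be + 1), (Prowe i f - ∑ j, Rtabe j f * Λ1e j i) * x i
            + ∑ j', ((∑ q ∈ se, coefe j' q * Pimge q f
                      - ∑ n ∈ Finset.range (Be + 1), ((if n = 0 then 1 else 2) * (Yoshida1992.fourierCoeff a n ((Icc (-a) a).indicator fun x : ℝ ↦ ∑ q ∈ se, ((coefe j' q : ℝ) : ℂ) * ((x : ℂ)) ^ q)).re / Real.sqrt (2 * a)) * Prowe n f)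
                    - ∑ j, Rtabe j f * Λ2e j j') * β j') ^ 2 * c f)
          + (1 + 1 / θe) * (We * ((∑ i : Fin (Be + 1), ρrowe i
                + ∑ j, (∑ q ∈ se, |coefe j q| * ρimge q
                    + ∑ n ∈ Finset.range (Be + 1), |((if n = 0 then 1 else 2) * (Yoshida1992.fourierCoeff a n ((Icc (-a) a).indicator fun x : ℝ ↦ ∑ q ∈ se, ((coefe j q : ℝ) : ℂ) * ((x : ℂ)) ^ q)).re / Real.sqrt (2 * a))| * ρrowe n))
              * (∑ i : Fin (Be + 1), ρrowe i * x i ^ 2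
                + ∑ j, (∑ q ∈ se, |coefe j q| * ρimge q
                    + ∑ n ∈ Finset.range (Be + 1), |((if n = 0 then 1 else 2) * (Yoshida1992.fourierCoeff a n ((Icc (-a) a).indicator fun x : ℝ ↦ ∑ q ∈ se, ((coefe j q : ℝ) : ℂ) * ((x : ℂ)) ^ q)).re / Real.sqrt (2 * a))| * ρrowe n) * β j ^ 2)))) / d₁e
      ≤ ∑ k, ∑ k', Sum.elim x β k * Sum.elim x β k' *
          (Uf k k' + ((1 + θe) * ((∑ f, ∑ f', Sum.elim (fun i : Fin (Be + 1) ↦ ((Prowe i f - ∑ j, Rtabe j f * Λ1e j i)))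
                  (fun j' : Fin re ↦ ((∑ q ∈ se, coefe j' q * Pimge q f
                      - ∑ n ∈ Finset.range (Be + 1), ((if n = 0 then 1 else 2) * (Yoshida1992.fourierCoeff a n ((Icc (-a) a).indicator fun x : ℝ ↦ ∑ q ∈ se, ((coefe j' q : ℝ) : ℂ) * ((x : ℂ)) ^ q)).re / Real.sqrt (2 * a)) * Prowe n f)
                    - ∑ j, Rtabe j f * Λ2e j j')) k
                * Sum.elim (fun i : Fin (Be + 1) ↦ ((Prowe i f' - ∑ j, Rtabe j f' * Λ1e j i)))
                  (fun j' : Fin re ↦ ((∑ q ∈ se, coefe j' q * Pimge q f'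
                      - ∑ n ∈ Finset.range (Be + 1), ((if n = 0 then 1 else 2) * (Yoshida1992.fourierCoeff a n ((Icc (-a) a).indicator fun x : ℝ ↦ ∑ q ∈ se, ((coefe j' q : ℝ) : ℂ) * ((x : ℂ)) ^ q)).re / Real.sqrt (2 * a)) * Prowe n f')
                    - ∑ j, Rtabe j f' * Λ2e j j')) k' * G f f')
              + ∑ f, c f * Sum.elim (fun i : Fin (Be + 1) ↦ ((Prowe i f - ∑ j, Rtabe j f * Λ1e j i)))
                  (fun j' : Fin re ↦ ((∑ q ∈ se, coefe j' q * Pimge q f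
                      - ∑ n ∈ Finset.range (Be + 1), ((if n = 0 then 1 else 2) * (Yoshida1992.fourierCoeff a n ((Icc (-a) a).indicator fun x : ℝ ↦ ∑ q ∈ se, ((coefe j' q : ℝ) : ℂ) * ((x : ℂ)) ^ q)).re / Real.sqrt (2 * a)) * Prowe n f)
                    - ∑ j, Rtabe j f * Λ2e j j')) k
                * Sum.elim (fun i : Fin (Be + 1) ↦ ((Prowe i f - ∑ j, Rtabe j f * Λ1e j i)))
                  (fun j' : Fin re ↦ ((∑ q ∈ se, coefe j' q * Pimge q f
                      - ∑ n ∈ Finset.range (Be + 1), ((if n = 0 then 1 else 2) * (Yoshida1992.fourierCoeff a n ((Icc (-a) a).indicator fun x : ℝ ↦ ∑ q ∈ se, ((coefe j' q : ℝ) : ℂ) * ((x : ℂ)) ^ q)).re / Real.sqrt (2 * a)) * Prowe n f)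
                    - ∑ j, Rtabe j f * Λ2e j j')) k')
            + (1 + 1 / θe) * (We * ((∑ i : Fin (Be + 1), ρrowe i
                + ∑ j, (∑ q ∈ se, |coefe j q| * ρimge q
                    + ∑ n ∈ Finset.range (Be + 1), |((if n = 0 then 1 else 2) * (Yoshida1992.fourierCoeff a n ((Icc (-a) a).indicator fun x : ℝ ↦ ∑ q ∈ se, ((coefe j q : ℝ) : ℂ) * ((x : ℂ)) ^ q)).re / Real.sqrt (2 * a))| * ρrowe n))))
              * (if k = k' then Sum.elim (fun i : Fin (Be + 1) ↦ ρrowe i)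
                  (fun j : Fin re ↦ (∑ q ∈ se, |coefe j q| * ρimge q
                    + ∑ n ∈ Finset.range (Be + 1), |((if n = 0 then 1 else 2) * (Yoshida1992.fourierCoeff a n ((Icc (-a) a).indicator fun x : ℝ ↦ ∑ q ∈ se, ((coefe j q : ℝ) : ℂ) * ((x : ℂ)) ^ q)).re / Real.sqrt (2 * a))| * ρrowe n)) k else 0)) / d₁e) :=
  le_of_eq (majorant_eq_quadForm Uf G c
    (fun (f : ι) (i : Fin (Be + 1)) ↦ ((Prowe i f - ∑ j, Rtabe j f * Λ1e j i)))
    (fun (f : ι) (j' : Fin re) ↦ ((∑ q ∈ se, coefe j' q * Pimge q f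
                      - ∑ n ∈ Finset.range (Be + 1), ((if n = 0 then 1 else 2) * (Yoshida1992.fourierCoeff a n ((Icc (-a) a).indicator fun x : ℝ ↦ ∑ q ∈ se, ((coefe j' q : ℝ) : ℂ) * ((x : ℂ)) ^ q)).re / Real.sqrt (2 * a)) * Prowe n f)
                    - ∑ j, Rtabe j f * Λ2e j j'))
    (fun i : Fin (Be + 1) ↦ ρrowe i) (fun j : Fin re ↦ (∑ q ∈ se, |coefe j q| * ρimge q
                    + ∑ n ∈ Finset.range (Be + 1), |((if n = 0 then 1 else 2) * (Yoshida1992.fourierCoeff a n ((Icc (-a) a).indicator fun x : ℝ ↦ ∑ q ∈ se, ((coefe j q : ℝ) : ℂ) * ((x : ℂ)) ^ q)).re / Real.sqrt (2 * a))| * ρrowe n))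
    θe We ((∑ i : Fin (Be + 1), ρrowe i
                + ∑ j, (∑ q ∈ se, |coefe j q| * ρimge q
                    + ∑ n ∈ Finset.range (Be + 1), |((if n = 0 then 1 else 2) * (Yoshida1992.fourierCoeff a n ((Icc (-a) a).indicator fun x : ℝ ↦ ∑ q ∈ se, ((coefe j q : ℝ) : ℂ) * ((x : ℂ)) ^ q)).re / Real.sqrt (2 * a))| * ρrowe n))) d₁e x β)

/-- **`hUqo'` of `weilPositivityOn_of_cinf_poly` by `le_of_eq`** (odd sector: block `Fin Bo`, low tables
`V⁻_j(n) = 2 Im ĉ_{n+1}(1f_j)/√(2a)` on `n < Bo`). -/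
theorem cinf_hUq'_odd (a : ℝ) {Bo ro : ℕ} (so : Finset ℕ) (coefo : Fin ro → ℕ → ℝ)
    (Λ1o : Fin ro → Fin Bo → ℝ) (Λ2o : Fin ro → Fin ro → ℝ)
    {ι : Type*} [Fintype ι] (Prowo : ℕ → ι → ℝ) (ρrowo : ℕ → ℝ) (Pimgo : ℕ → ι → ℝ) (ρimgo : ℕ → ℝ)
    (Rtabo : Fin ro → ι → ℝ) (Wo θo d₁o : ℝ)
    (Uf : Fin Bo ⊕ Fin ro → Fin Bo ⊕ Fin ro → ℝ) (G : ι → ι → ℝ) (c : ι → ℝ)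
    (x : Fin Bo → ℝ) (β : Fin ro → ℝ) :
    (∑ k, ∑ k', Sum.elim x β k * Sum.elim x β k' * Uf k k')
        + ((1 + θo) * ((∑ f, ∑ f', (∑ i : Fin Bo, (Prowo i f - ∑ j, Rtabo j f * Λ1o j i) * x i
            + ∑ j', ((∑ q ∈ so, coefo j' q * Pimgo q f
                      - ∑ n ∈ Finset.Ico 0 Bo, (2 * (Yoshida1992.fourierCoeff a ((n : ℤ) + 1) ((Icc (-a) a).indicator fun x : ℝ ↦ ∑ q ∈ so, ((coefo j' q : ℝ) : ℂ) * ((x : ℂ)) ^ q)).im / Real.sqrt (2 * a)) * Prowo n f)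
                    - ∑ j, Rtabo j f * Λ2o j j') * β j')
              * (∑ i : Fin Bo, (Prowo i f' - ∑ j, Rtabo j f' * Λ1o j i) * x i
            + ∑ j', ((∑ q ∈ so, coefo j' q * Pimgo q f'
                      - ∑ n ∈ Finset.Ico 0 Bo, (2 * (Yoshida1992.fourierCoeff a ((n : ℤ) + 1) ((Icc (-a) a).indicator fun x : ℝ ↦ ∑ q ∈ so, ((coefo j' q : ℝ) : ℂ) * ((x : ℂ)) ^ q)).im / Real.sqrt (2 * a)) * Prowo n f')
                    - ∑ j, Rtabo j f' * Λ2o j j') * β j') * G f f')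
            + ∑ f, (∑ i : Fin Bo, (Prowo i f - ∑ j, Rtabo j f * Λ1o j i) * x i
            + ∑ j', ((∑ q ∈ so, coefo j' q * Pimgo q f
                      - ∑ n ∈ Finset.Ico 0 Bo, (2 * (Yoshida1992.fourierCoeff a ((n : ℤ) + 1) ((Icc (-a) a).indicator fun x : ℝ ↦ ∑ q ∈ so, ((coefo j' q : ℝ) : ℂ) * ((x : ℂ)) ^ q)).im / Real.sqrt (2 * a)) * Prowo n f)
                    - ∑ j, Rtabo j f * Λ2o j j') * β j') ^ 2 * c f)
          + (1 + 1 / θo) * (Wo * ((∑ i : Fin Bo, ρrowo i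
                + ∑ j, (∑ q ∈ so, |coefo j q| * ρimgo q
                    + ∑ n ∈ Finset.Ico 0 Bo, |(2 * (Yoshida1992.fourierCoeff a ((n : ℤ) + 1) ((Icc (-a) a).indicator fun x : ℝ ↦ ∑ q ∈ so, ((coefo j q : ℝ) : ℂ) * ((x : ℂ)) ^ q)).im / Real.sqrt (2 * a))| * ρrowo n))
              * (∑ i : Fin Bo, ρrowo i * x i ^ 2
                + ∑ j, (∑ q ∈ so, |coefo j q| * ρimgo q
                    + ∑ n ∈ Finset.Ico 0 Bo, |(2 * (Yoshida1992.fourierCoeff a ((n : ℤ) + 1) ((Icc (-a) a).indicator fun x : ℝ ↦ ∑ q ∈ so, ((coefo j q : ℝ) : ℂ) * ((x : ℂ)) ^ q)).im / Real.sqrt (2 * a))| * ρrowo n) * β j ^ 2)))) / d₁o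
      ≤ ∑ k, ∑ k', Sum.elim x β k * Sum.elim x β k' *
          (Uf k k' + ((1 + θo) * ((∑ f, ∑ f', Sum.elim (fun i : Fin Bo ↦ ((Prowo i f - ∑ j, Rtabo j f * Λ1o j i)))
                  (fun j' : Fin ro ↦ ((∑ q ∈ so, coefo j' q * Pimgo q f
                      - ∑ n ∈ Finset.Ico 0 Bo, (2 * (Yoshida1992.fourierCoeff a ((n : ℤ) + 1) ((Icc (-a) a).indicator fun x : ℝ ↦ ∑ q ∈ so, ((coefo j' q : ℝ) : ℂ) * ((x : ℂ)) ^ q)).im / Real.sqrt (2 * a)) * Prowo n f)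
                    - ∑ j, Rtabo j f * Λ2o j j')) k
                * Sum.elim (fun i : Fin Bo ↦ ((Prowo i f' - ∑ j, Rtabo j f' * Λ1o j i)))
                  (fun j' : Fin ro ↦ ((∑ q ∈ so, coefo j' q * Pimgo q f'
                      - ∑ n ∈ Finset.Ico 0 Bo, (2 * (Yoshida1992.fourierCoeff a ((n : ℤ) + 1) ((Icc (-a) a).indicator fun x : ℝ ↦ ∑ q ∈ so, ((coefo j' q : ℝ) : ℂ) * ((x : ℂ)) ^ q)).im / Real.sqrt (2 * a)) * Prowo n f')
                    - ∑ j, Rtabo j f' * Λ2o j j')) k' * G f f')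
              + ∑ f, c f * Sum.elim (fun i : Fin Bo ↦ ((Prowo i f - ∑ j, Rtabo j f * Λ1o j i)))
                  (fun j' : Fin ro ↦ ((∑ q ∈ so, coefo j' q * Pimgo q f
                      - ∑ n ∈ Finset.Ico 0 Bo, (2 * (Yoshida1992.fourierCoeff a ((n : ℤ) + 1) ((Icc (-a) a).indicator fun x : ℝ ↦ ∑ q ∈ so, ((coefo j' q : ℝ) : ℂ) * ((x : ℂ)) ^ q)).im / Real.sqrt (2 * a)) * Prowo n f)
                    - ∑ j, Rtabo j f * Λ2o j j')) k
                * Sum.elim (fun i : Fin Bo ↦ ((Prowo i f - ∑ j, Rtabo j f * Λ1o j i)))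
                  (fun j' : Fin ro ↦ ((∑ q ∈ so, coefo j' q * Pimgo q f
                      - ∑ n ∈ Finset.Ico 0 Bo, (2 * (Yoshida1992.fourierCoeff a ((n : ℤ) + 1) ((Icc (-a) a).indicator fun x : ℝ ↦ ∑ q ∈ so, ((coefo j' q : ℝ) : ℂ) * ((x : ℂ)) ^ q)).im / Real.sqrt (2 * a)) * Prowo n f)
                    - ∑ j, Rtabo j f * Λ2o j j')) k')
            + (1 + 1 / θo) * (Wo * ((∑ i : Fin Bo, ρrowo i
                + ∑ j, (∑ q ∈ so, |coefo j q| * ρimgo q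
                    + ∑ n ∈ Finset.Ico 0 Bo, |(2 * (Yoshida1992.fourierCoeff a ((n : ℤ) + 1) ((Icc (-a) a).indicator fun x : ℝ ↦ ∑ q ∈ so, ((coefo j q : ℝ) : ℂ) * ((x : ℂ)) ^ q)).im / Real.sqrt (2 * a))| * ρrowo n))))
              * (if k = k' then Sum.elim (fun i : Fin Bo ↦ ρrowo i)
                  (fun j : Fin ro ↦ (∑ q ∈ so, |coefo j q| * ρimgo q
                    + ∑ n ∈ Finset.Ico 0 Bo, |(2 * (Yoshida1992.fourierCoeff a ((n : ℤ) + 1) ((Icc (-a) a).indicator fun x : ℝ ↦ ∑ q ∈ so, ((coefo j q : ℝ) : ℂ) * ((x : ℂ)) ^ q)).im / Real.sqrt (2 * a))| * ρrowo n)) k else 0)) / d₁o) :=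
  le_of_eq (majorant_eq_quadForm Uf G c
    (fun (f : ι) (i : Fin Bo) ↦ ((Prowo i f - ∑ j, Rtabo j f * Λ1o j i)))
    (fun (f : ι) (j' : Fin ro) ↦ ((∑ q ∈ so, coefo j' q * Pimgo q f
                      - ∑ n ∈ Finset.Ico 0 Bo, (2 * (Yoshida1992.fourierCoeff a ((n : ℤ) + 1) ((Icc (-a) a).indicator fun x : ℝ ↦ ∑ q ∈ so, ((coefo j' q : ℝ) : ℂ) * ((x : ℂ)) ^ q)).im / Real.sqrt (2 * a)) * Prowo n f)
                    - ∑ j, Rtabo j f * Λ2o j j'))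
    (fun i : Fin Bo ↦ ρrowo i) (fun j : Fin ro ↦ (∑ q ∈ so, |coefo j q| * ρimgo q
                    + ∑ n ∈ Finset.Ico 0 Bo, |(2 * (Yoshida1992.fourierCoeff a ((n : ℤ) + 1) ((Icc (-a) a).indicator fun x : ℝ ↦ ∑ q ∈ so, ((coefo j q : ℝ) : ℂ) * ((x : ℂ)) ^ q)).im / Real.sqrt (2 * a))| * ρrowo n))
    θo Wo ((∑ i : Fin Bo, ρrowo i
                + ∑ j, (∑ q ∈ so, |coefo j q| * ρimgo q
                    + ∑ n ∈ Finset.Ico 0 Bo, |(2 * (Yoshida1992.fourierCoeff a ((n : ℤ) + 1) ((Icc (-a) a).indicator fun x : ℝ ↦ ∑ q ∈ so, ((coefo j q : ℝ) : ℂ) * ((x : ℂ)) ^ q)).im / Real.sqrt (2 * a))| * ρrowo n))) d₁o x β)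

end Summit.RiemannHypothesis.RiemannHypothesis.Theorems.WeilFormatC

end
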